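import Mathlib

/-!
# `HyperbolicEnd` (stmt-SmoothPoincare4-7825), line `Sketch`, negative side — flat inequality for the neck density

Helper for `Theorems/HyperbolicEnd/Negative/FrozenFill.lean` (frozen-J certificate filling fails
in complex dimension one). Statement registered on the crux item (stub helper_neckDensity).

**The computation.** For the neck density `Φ₀(x) = 1 + 81/‖x‖⁴` on `ℂ ∖ {0}` write
`q = ‖x‖² = re² + im²`.  Along a real line `t ↦ x + t v` one has
`‖x + t v‖² = q + 2Bt + Nt²` (`B = ⟨x, v⟩`, `N = ‖v‖²`), so the slice of `Φ₀` is the explicit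
rational function `1 + 81/(q + 2Bt + Nt²)²`, with first derivative `-324 B/q³` and second
derivative `(-324 N q + 1944 B²)/q⁴` at `t = 0`.  Reading off `DΦ₀(x)v` and `D²Φ₀(x)[v, v]`
(`fderiv_iteratedFDeriv_of_line`, copied from the model-pair stub) for `v = 1, I` gives
`|∇Φ₀|² = 104976/q⁵`, `ΔΦ₀ = 1296/q³`, hence `Φ₀ ΔΦ₀ - |∇Φ₀|² = 1296/q³` exactly, and
`2 · (1/1000) · Φ₀³ ≤ 1296/q³` on `1 < q < 16` reduces to `(q² + 81)³ ≤ 648000 q³`, which follows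
from `q² + 81 ≤ 82 q` there and `82³ = 551368`.
-/

noncomputable section

-- the prescribed namespace `Summit.<P>.<Sub>.…` duplicates `SmoothPoincare4` (P = Sub)
set_option linter.dupNamespace false

open scoped ContDiff Topology Real
open Laplacian Set Filter Metric Complex

namespace Summit.SmoothPoincare4.SmoothPoincare4.Theorems.HyperbolicEnd.Negative

/-! ### One-variable reduction: derivatives along real lines -/

/-- **Line lemma.** For a real function `f` on `ℂ`, `C²` at `z`, the directional derivatives
`Df(z) v` and `D²f(z)[v, v]` are the first and second derivatives at `0` of the slice
`t ↦ f (z + t v)`, read off from one-variable `HasDerivAt` data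
(copied from `Theorems/SullivanDualHyperbolicEndStubModelPair.lean`). -/
private theorem fderiv_iteratedFDeriv_of_line {f : ℂ → ℝ} {z v : ℂ} (hf : ContDiffAt ℝ 2 f z)
    {m₁ : ℝ → ℝ} {m₂ : ℝ}
    (h₁ : ∀ᶠ t in 𝓝 (0 : ℝ), HasDerivAt (fun s : ℝ => f (z + s * v)) (m₁ t) t)
    (h₂ : HasDerivAt m₁ m₂ 0) :
    fderiv ℝ f z v = m₁ 0 ∧ iteratedFDeriv ℝ 2 f z ![v, v] = m₂ := by
  -- the line through `z` in direction `v`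
  set γ : ℝ → ℂ := fun t => z + t * v with hγ_def
  have hγ : ∀ t, HasDerivAt γ v t := fun t => by
    have h := (((hasDerivAt_id (t : ℂ)).mul_const v).const_add z).comp_ofReal
    simpa [hγ_def] using h
  have hγ0 : γ 0 = z := by simp [hγ_def]
  -- `f` is differentiable near `z`, `Df` is differentiable at `z`
  have hev : ∀ᶠ y in 𝓝 z, DifferentiableAt ℝ f y := by
    filter_upwards [hf.eventually (by simp)] with y hy
    exact hy.differentiableAt (by simp)
  have hD : DifferentiableAt ℝ (fderiv ℝ f) z :=
    (hf.fderiv_right (m := 1) (by norm_num)).differentiableAt one_ne_zero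
  -- the slice and its first derivative near `0`
  have hφ' : ∀ᶠ t in 𝓝 (0 : ℝ), HasDerivAt (fun s : ℝ => f (z + s * v)) (fderiv ℝ f (γ t) v) t := by
    have : ∀ᶠ t in 𝓝 (0 : ℝ), DifferentiableAt ℝ f (γ t) := by
      have hcont : ContinuousAt γ 0 := (hγ 0).continuousAt
      rw [← hγ0] at hev
      exact hcont.eventually hev
    filter_upwards [this] with t ht
    exact ht.hasFDerivAt.comp_hasDerivAt t (hγ t)
  -- so `m₁` agrees with `t ↦ Df(γ t) v` near `0`
  have hm₁ : m₁ =ᶠ[𝓝 0] fun t => fderiv ℝ f (γ t) v := by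
    filter_upwards [h₁, hφ'] with t ht ht'
    exact ht.unique ht'
  refine ⟨?_, ?_⟩
  · have h0 := hm₁.eq_of_nhds
    simp only [hγ0] at h0
    exact h0.symm
  · -- second derivative of the slice at `0`
    have h1 : HasDerivAt (fderiv ℝ f ∘ γ) (fderiv ℝ (fderiv ℝ f) (γ 0) v) 0 := by
      have hD' : DifferentiableAt ℝ (fderiv ℝ f) (γ 0) := by rw [hγ0]; exact hD
      exact hD'.hasFDerivAt.comp_hasDerivAt 0 (hγ 0)
    rw [hγ0] at h1
    have h2 := h1.clm_apply (hasDerivAt_const (0 : ℝ) v)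
    simp only [ContinuousLinearMap.map_zero, add_zero, Function.comp_apply] at h2
    -- `h2 : HasDerivAt (fun t => fderiv ℝ f (γ t) v) (fderiv ℝ (fderiv ℝ f) z v v) 0`
    have h3 : HasDerivAt m₁ (fderiv ℝ (fderiv ℝ f) z v v) 0 := h2.congr_of_eventuallyEq hm₁
    rw [iteratedFDeriv_two_apply]
    simpa using (h₂.unique h3).symm

/-! ### The neck density along a line -/

/-- `‖z + t v‖² = ‖z‖² + 2t⟨z, v⟩ + t²‖v‖²` in real coordinates. -/
private theorem norm_sq_line (z v : ℂ) (t : ℝ) :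
    ‖z + t * v‖ ^ 2 =
      ‖z‖ ^ 2 + 2 * (z.re * v.re + z.im * v.im) * t + (v.re ^ 2 + v.im ^ 2) * t ^ 2 := by
  simp only [Complex.sq_norm, Complex.normSq_apply, Complex.add_re, Complex.add_im,
    Complex.mul_re, Complex.mul_im, Complex.ofReal_re, Complex.ofReal_im]
  ring

/-- Derivative of the quadratic `s ↦ A + 2Bs + Ns²`. -/
private theorem hasDerivAt_quad (A B N t : ℝ) :
    HasDerivAt (fun s : ℝ => A + 2 * B * s + N * s ^ 2) (2 * B + N * (2 * t)) t := by
  have h1 : HasDerivAt (fun s : ℝ => 2 * B * s) (2 * B) t := by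
    simpa using (hasDerivAt_id' t).const_mul (2 * B)
  have h2 : HasDerivAt (fun s : ℝ => N * s ^ 2) (N * (2 * t)) t := by
    simpa using (hasDerivAt_pow 2 t).const_mul N
  exact (h1.const_add A).fun_add h2

/-- Derivative of the slice `s ↦ 1 + 81/(A + 2Bs + Ns²)²` of the neck density, where the
quadratic does not vanish. -/
private theorem hasDerivAt_slice (A B N t : ℝ) (h : A + 2 * B * t + N * t ^ 2 ≠ 0) :
    HasDerivAt (fun s : ℝ => 1 + 81 / (A + 2 * B * s + N * s ^ 2) ^ 2)
      (-324 * (B + N * t) / (A + 2 * B * t + N * t ^ 2) ^ 3) t := by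
  have h2 := (hasDerivAt_quad A B N t).fun_pow 2
  have h3 := ((hasDerivAt_const t (81 : ℝ)).fun_div h2 (pow_ne_zero 2 h)).const_add (1 : ℝ)
  refine h3.congr_deriv ?_
  simp only [Nat.cast_ofNat, Nat.add_one_sub_one, pow_one, zero_mul, zero_sub]
  field_simp
  ring

/-- Derivative at `0` of `s ↦ -324(B + Ns)/(A + 2Bs + Ns²)³` (the first derivative of the slice),
for `A ≠ 0`. -/
private theorem hasDerivAt_slice' (A B N : ℝ) (hA : A ≠ 0) :
    HasDerivAt (fun s : ℝ => -324 * (B + N * s) / (A + 2 * B * s + N * s ^ 2) ^ 3)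
      ((-324 * N * A + 1944 * B ^ 2) / A ^ 4) 0 := by
  have h3 := (hasDerivAt_quad A B N 0).fun_pow 3
  have hn : HasDerivAt (fun s : ℝ => -324 * (B + N * s)) (-324 * N) 0 := by
    have h : HasDerivAt (fun s : ℝ => N * s) N 0 := by
      simpa using (hasDerivAt_id' (0 : ℝ)).const_mul N
    exact (h.const_add B).const_mul (-324)
  have hQ : A + 2 * B * 0 + N * (0 : ℝ) ^ 2 ≠ 0 := by simpa using hA
  refine (hn.fun_div h3 (pow_ne_zero 3 hQ)).congr_deriv ?_
  simp only [Nat.cast_ofNat, Nat.add_one_sub_one, mul_zero, add_zero, ne_eq, OfNat.ofNat_ne_zero,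
    not_false_eq_true, zero_pow]
  field_simp
  ring

/-- The neck density `Φ₀ x = 1 + 81/‖x‖⁴` is smooth off the origin. -/
private theorem neck_contDiffAt {n : WithTop ℕ∞} {z : ℂ} (hz : z ≠ 0) :
    ContDiffAt ℝ n (fun x : ℂ => (1 + 81 / (‖x‖ ^ 2) ^ 2 : ℝ)) z := by
  have h1 : ContDiffAt ℝ n (fun x : ℂ => (‖x‖ ^ 2) ^ 2) z :=
    (contDiff_norm_sq ℝ (n := n)).contDiffAt.pow 2
  exact contDiffAt_const.add
    (contDiffAt_const.div h1 (pow_ne_zero 2 (pow_ne_zero 2 (norm_ne_zero_iff.2 hz))))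

/-- **Direction lemma.** First and second derivatives of the neck density at `z ≠ 0` in the
direction `v`, with `B = ⟨z, v⟩ = re z re v + im z im v` and `N = ‖v‖² = re v² + im v²`:
`DΦ₀(z)v = -324 B/‖z‖⁶` and `D²Φ₀(z)[v, v] = (-324 N ‖z‖² + 1944 B²)/‖z‖⁸`. -/
private theorem neck_line {z : ℂ} (hz : z ≠ 0) (v : ℂ) {B N : ℝ}
    (hB : z.re * v.re + z.im * v.im = B) (hN : v.re ^ 2 + v.im ^ 2 = N) :
    fderiv ℝ (fun x : ℂ => (1 + 81 / (‖x‖ ^ 2) ^ 2 : ℝ)) z v = -324 * B / (‖z‖ ^ 2) ^ 3 ∧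
      iteratedFDeriv ℝ 2 (fun x : ℂ => (1 + 81 / (‖x‖ ^ 2) ^ 2 : ℝ)) z ![v, v] =
        (-324 * N * ‖z‖ ^ 2 + 1944 * B ^ 2) / (‖z‖ ^ 2) ^ 4 := by
  have hA0 : ‖z‖ ^ 2 ≠ 0 := pow_ne_zero 2 (norm_ne_zero_iff.2 hz)
  -- the slice is an explicit rational function of `t`
  have hfun : (fun s : ℝ => (1 + 81 / (‖z + s * v‖ ^ 2) ^ 2 : ℝ)) =
      fun s => 1 + 81 / (‖z‖ ^ 2 + 2 * B * s + N * s ^ 2) ^ 2 := by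
    funext s
    rw [norm_sq_line, hB, hN]
  -- near `0` the quadratic does not vanish
  have hnear : ∀ᶠ t : ℝ in 𝓝 0, ‖z‖ ^ 2 + 2 * B * t + N * t ^ 2 ≠ 0 := by
    have hc : Continuous fun t : ℝ => ‖z‖ ^ 2 + 2 * B * t + N * t ^ 2 := by fun_prop
    exact hc.continuousAt.eventually_ne (by simpa using hA0)
  have h₁ : ∀ᶠ t : ℝ in 𝓝 0, HasDerivAt (fun s : ℝ => (1 + 81 / (‖z + s * v‖ ^ 2) ^ 2 : ℝ))
      (-324 * (B + N * t) / (‖z‖ ^ 2 + 2 * B * t + N * t ^ 2) ^ 3) t := by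
    rw [hfun]
    exact hnear.mono fun t ht => hasDerivAt_slice _ B N t ht
  have h₂ := hasDerivAt_slice' (‖z‖ ^ 2) B N hA0
  obtain ⟨e1, e2⟩ := fderiv_iteratedFDeriv_of_line (v := v) (neck_contDiffAt hz) h₁ h₂
  refine ⟨?_, e2⟩
  rw [e1]
  simp

/-! ### The final real inequality -/

/-- **The algebra.** With `A = a² + b²` (`= ‖x‖²`) in `(1, 16)`, the explicit derivatives give
`Φ₀ ΔΦ₀ - |∇Φ₀|² = 1296/A³ ≥ 2 · (1/1000) · (1 + 81/A²)³`. -/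
private theorem final_ineq {A a b : ℝ} (hA : A = a ^ 2 + b ^ 2) (h1 : 1 < A) (h16 : A < 16) :
    2 * (1 / 1000) * (1 + 81 / A ^ 2) ^ 3 ≤
      (1 + 81 / A ^ 2) *
          ((-324 * 1 * A + 1944 * a ^ 2) / A ^ 4 + (-324 * 1 * A + 1944 * b ^ 2) / A ^ 4) -
        ((-324 * a / A ^ 3) ^ 2 + (-324 * b / A ^ 3) ^ 2) := by
  have hA0 : 0 < A := by linarith
  -- `A² + 81 ≤ 82 A` on `[1, 81]`, so `(A² + 81)³ ≤ 82³ A³ = 551368 A³ ≤ 648000 A³`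
  have hq : A ^ 2 + 81 ≤ 82 * A := by nlinarith
  have h3 : (A ^ 2 + 81) ^ 3 ≤ (82 * A) ^ 3 := pow_le_pow_left₀ (by positivity) hq 3
  have hkey : 0 ≤ 648000 * A ^ 3 - (A ^ 2 + 81) ^ 3 := by nlinarith [h3, pow_pos hA0 3]
  have hA6 : 0 < 500 * A ^ 6 := by positivity
  -- the exact identity `Φ₀ ΔΦ₀ - |∇Φ₀|² - 2 · 10⁻³ · Φ₀³ = (648000 A³ - (A² + 81)³)/(500 A⁶)`
  subst hA
  have hne : a ^ 2 + b ^ 2 ≠ 0 := hA0.ne'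
  have key : (1 + 81 / (a ^ 2 + b ^ 2) ^ 2) *
          ((-324 * 1 * (a ^ 2 + b ^ 2) + 1944 * a ^ 2) / (a ^ 2 + b ^ 2) ^ 4 +
            (-324 * 1 * (a ^ 2 + b ^ 2) + 1944 * b ^ 2) / (a ^ 2 + b ^ 2) ^ 4) -
        ((-324 * a / (a ^ 2 + b ^ 2) ^ 3) ^ 2 + (-324 * b / (a ^ 2 + b ^ 2) ^ 3) ^ 2) -
        2 * (1 / 1000) * (1 + 81 / (a ^ 2 + b ^ 2) ^ 2) ^ 3 =
      (648000 * (a ^ 2 + b ^ 2) ^ 3 - ((a ^ 2 + b ^ 2) ^ 2 + 81) ^ 3) /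
        (500 * (a ^ 2 + b ^ 2) ^ 6) := by
    field_simp
    ring
  rw [← sub_nonneg, key]
  exact div_nonneg hkey hA6.le

/-! ### The helper -/

/-- helper (W-A'): the flat inequality for the neck density `Φ₀ x = 1 + 81/‖x‖⁴` on the annulus
`1 < ‖x‖ < 4` (`Φ₀ ΔΦ₀ - |∇Φ₀|² = 1296/‖x‖⁶ ≥ 2·(1/1000)·Φ₀³`), with its smoothness off `0`. -/
theorem helper_neckDensity :
    ContDiffOn ℝ ∞ (fun x : ℂ => (1 + 81 / (‖x‖ ^ 2) ^ 2 : ℝ)) {x : ℂ | x ≠ 0} ∧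
    ∀ x : ℂ, 1 < ‖x‖ → ‖x‖ < 4 →
      2 * (1 / 1000) * (1 + 81 / (‖x‖ ^ 2) ^ 2) ^ 3 ≤
        (1 + 81 / (‖x‖ ^ 2) ^ 2) * (Δ (fun x : ℂ => (1 + 81 / (‖x‖ ^ 2) ^ 2 : ℝ))) x -
          ((fderiv ℝ (fun x : ℂ => (1 + 81 / (‖x‖ ^ 2) ^ 2 : ℝ)) x 1) ^ 2 +
            (fderiv ℝ (fun x : ℂ => (1 + 81 / (‖x‖ ^ 2) ^ 2 : ℝ)) x Complex.I) ^ 2) := by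
  refine ⟨fun x hx => (neck_contDiffAt hx).contDiffWithinAt, fun x h1 h4 => ?_⟩
  have hx : x ≠ 0 := norm_pos_iff.1 (by linarith)
  obtain ⟨e1, e2⟩ := neck_line hx 1 (B := x.re) (N := 1) (by simp) (by simp)
  obtain ⟨f1, f2⟩ := neck_line hx Complex.I (B := x.im) (N := 1) (by simp) (by simp)
  rw [InnerProductSpace.laplacian_eq_iteratedFDeriv_complexPlane]
  beta_reduce
  rw [e1, e2, f1, f2]
  have hA : ‖x‖ ^ 2 = x.re ^ 2 + x.im ^ 2 := by
    rw [Complex.sq_norm, Complex.normSq_apply]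
    ring
  have hA1 : 1 < ‖x‖ ^ 2 := by nlinarith [norm_nonneg x]
  have hA16 : ‖x‖ ^ 2 < 16 := by nlinarith [norm_nonneg x]
  exact final_ineq hA hA1 hA16

end Summit.SmoothPoincare4.SmoothPoincare4.Theorems.HyperbolicEnd.Negative

end
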